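import Summits.ResolutionOfSingularities.ResolutionOfSingularities.Theorems.WeightedInvariantELadderTwoOverCentreStage
import Summits.ResolutionOfSingularities.ResolutionOfSingularities.Theorems.WeightedInvariantELadderTwoOffCentre
import Summits.ResolutionOfSingularities.ResolutionOfSingularities.Theorems.WeightedInvariantELadderTwoMuAttained
import Summits.ResolutionOfSingularities.ResolutionOfSingularities.Theorems.WeightedInvariantELadderTwoMaxNonempty
import Summits.ResolutionOfSingularities.ResolutionOfSingularities.Theorems.WeightedInvariantELadderTwoGenSingNonempty
import Summits.ResolutionOfSingularities.ResolutionOfSingularities.Theorems.WeightedInvariantHypersurfaceCentreAssemblyExcDrop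
import HarnessLib

/-!
# E2 tier, (o59-loc) `E2InvSuccLocBody`: the SUPREMUM STEP — `mu₂' < mu₂` for a compatible successor — and the registered stub
# `stub_e2_inv_succ_loc_h` BY NAME

Route `ResolutionOfSingularities/WeightedInvariant`, crux `Theses.WeightedInvariant.HypersurfaceCentreConstruction`
(stmt-ResolutionOfSingularities-19897), door line `local-engine` (skeleton v3.12, 7a4b52ef4f5779aa), E2 tier, registered stub
`stub_e2_inv_succ_loc_h : ∀ p, p.Prime → ∀ ι J, PRungGrHomLE 3 p ι J → E2InvSuccLocBody p ι J` (LOCAL DROP of `mu₂` for compatible successors).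
The tree has the POINTWISE drop at every read point of a compatible successor — OVER the centre (`Stage.iotaAt_lt_mu₂_of_succCompatible_overCentre`,
…ELadderTwoOverCentreStage: (c6)+(c-u)+(c9′-hom)≤3) and OFF it (`Stage.iotaAt_lt_mu₂_of_succCompatible_offCentre`, …ELadderTwoOffCentre: (c10)≤3) — with
the `k₀`-algebra / essentially-finite-type / regular structure of the base stalk, its dimension bound and the order conditions on the local equations as
HYPOTHESES; «the remaining step of `E2InvSuccLocBody` is the supremum» (…OverCentreStage docstring).  This file discharges the stalk hypotheses (the stalk
`𝒪_{Y,y}` is the localisation of the finite-type `k`-algebra `Γ(Y, U)` at `𝔭(y)`; regular since `Y` is smooth; `dim ≤ 3`, `f_y ≠ 0`, `f_y ∈ 𝔪²` at a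
read point; `f'_{η'} ∈ 𝔪'²` at a read point of the successor) and takes the supremum: if `X'` is not regular, `mu₂'` is ATTAINED at a read point
(`exists_isMaxOn_iotaAt_genSing₂`, (c8-gr)≤3) where the pointwise drop applies.
* `Stage.iotaAt_lt_mu₂_of_succCompatible` — pointwise drop at every read point of a compatible successor, hypotheses discharged;
* `e2InvSuccLoc` — `PRungGrHomLE 3 p ι J → E2InvSuccLocBody p ι J`;
* `stub_e2_inv_succ_loc_h` — THE REGISTERED STUB BY NAME.
[OURS · L1 W4.3 · the E2 tier is OUR construction; nothing here is a statement of Hironaka 2017; AI-written, weaker than expert review.]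
-/

noncomputable section

set_option linter.dupNamespace false -- mandated namespace of this single-conjunct summit

open CategoryTheory AlgebraicGeometry TopologicalSpace IsLocalRing Topology
open Literature.AlgebraicGeometry.Resolution
open Summit.ResolutionOfSingularities.ResolutionOfSingularities.Theorems
open Summit.ResolutionOfSingularities.ResolutionOfSingularities.Cruxes.HypersurfaceCentreConstruction.LocalEngine

namespace Summit.ResolutionOfSingularities.ResolutionOfSingularities.Theorems.ELadderOne.Stage

variable {k : Type} [Field k] {p : ℕ} (ι : (R : Type) → [CommRing R] → R → Ordinal.{0})
  (J : (R : Type) → [CommRing R] → R → ℕ → Ideal R)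

/-- **POINTWISE DROP AT EVERY READ POINT OF A COMPATIBLE SUCCESSOR, hypotheses discharged.**  Under the graded HOM rung, for a canonical e = 2 centre
`R` of the stage `S`, a compatible successor `(S', π)` and a read point `η' ∈ genSing₂'`: `ι_{η'} < mu₂`. [folklore] -/
theorem iotaAt_lt_mu₂_of_succCompatible [CharP k p] [PerfectField k] (hr : PRungGrHomLE 3 p ι J)
    (S S' : Stage k) {R : ReesAlgebraData S.Y} (π : S'.Y ⟶ S.Y) (hR : S.IsCanonicalCentre₂ ι J R)
    (hc : S.SuccCompatible ι R S' π) {η' : S'.Y} (hη' : η' ∈ S'.genSing₂) :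
    iotaAt ι S'.i.ker η' < S.mu₂ ι := by
  classical
  have hiso : IotaIsoInvariant ι := hr.1.1
  have hc10 : IotaTorusFactorMonotoneLE 3 p ι := hr.1.2.2.2.1
  have hgame : CanonicalGameClauseHomLE 3 p ι J := hr.1.2.2.2.2.2.2.1
  have hunit : IotaUnitInvariant ι := hr.1.2.2.2.2.2.2.2.2.1
  set y := π.base η' with hy
  -- the base point `y` is a read point of `S` in either branch
  have hygen : y ∈ S.genSing₂ := by
    by_cases hsupp : y ∈ R.support
    · exact S.maxLocus₂_subset_genSing₂ ι (hc.overCentre η' hη' hsupp).1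
    · exact (hc.offCentre η' hη' hsupp).1
  -- the stalk `𝒪_{Y,y}`: a regular local `k`-algebra essentially of finite type, of dimension `≤ 3`
  obtain ⟨U, hyU, G, hG⟩ := S.isLocallyPrincipal y
  have hft : RingHom.FiniteType (S.f.appLE ⊤ U le_top).hom :=
    HasRingHomProperty.appLE @LocallyOfFiniteType S.f inferInstance ⟨⊤, isAffineOpen_top _⟩ U le_top
  let φ : k →+* Γ(S.Y, U) := (S.f.appLE ⊤ U le_top).hom.comp (Scheme.ΓSpecIso (.of k)).inv.hom
  have hφ : φ.FiniteType :=
    hft.comp (RingHom.FiniteType.of_surjective _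
      (Scheme.ΓSpecIso (.of k)).commRingCatIsoToRingEquiv.symm.surjective)
  letI : Algebra k Γ(S.Y, U) := φ.toAlgebra
  haveI : Algebra.FiniteType k Γ(S.Y, U) := hφ
  letI := S.Y.presheaf.algebra_section_stalk (⟨y, hyU⟩ : (U : S.Y.Opens))
  haveI hloc : IsLocalization.AtPrime (S.Y.presheaf.stalk y) (U.2.primeIdealOf ⟨y, hyU⟩).asIdeal := U.2.isLocalization_stalk ⟨y, hyU⟩
  letI : Algebra k (S.Y.presheaf.stalk y) := ((algebraMap Γ(S.Y, U) (S.Y.presheaf.stalk y)).comp (algebraMap k Γ(S.Y, U))).toAlgebra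
  haveI : IsScalarTower k Γ(S.Y, U) (S.Y.presheaf.stalk y) := IsScalarTower.of_algebraMap_eq fun _ => rfl
  haveI : Algebra.EssFiniteType Γ(S.Y, U) (S.Y.presheaf.stalk y) :=
    Algebra.EssFiniteType.of_isLocalization (S.Y.presheaf.stalk y) (U.2.primeIdealOf ⟨y, hyU⟩).asIdeal.primeCompl
  haveI : Algebra.EssFiniteType k (S.Y.presheaf.stalk y) := Algebra.EssFiniteType.comp k Γ(S.Y, U) (S.Y.presheaf.stalk y)
  haveI : IsRegularLocalRing (S.Y.presheaf.stalk y) := isRegularLocalRing_stalk_of_smooth_of_field S.f y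
  haveI : IsRegularLocalRing (S'.Y.presheaf.stalk η') := isRegularLocalRing_stalk_of_smooth_of_field S'.f η'
  have hdim : ringKrullDim (S.Y.presheaf.stalk y) ≤ 3 := hygen.2.2
  -- order conditions on the local equations
  have hXy : ∃ g : S.Y.presheaf.stalk y, stalkIdeal S.i.ker y = Ideal.span {g} :=
    (S.isLocallyPrincipal y).isPrincipal_stalkIdeal.principal
  have hX'η : ∃ g : S'.Y.presheaf.stalk η', stalkIdeal S'.i.ker η' = Ideal.span {g} :=
    (S'.isLocallyPrincipal η').isPrincipal_stalkIdeal.principal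
  have hf2 : localGenerator S.i.ker y ∈ maximalIdeal (S.Y.presheaf.stalk y) ^ 2 :=
    localGenerator_mem_sq_of_mem_singImage S.i.ker y hXy hygen.1
  have hf0 : localGenerator S.i.ker y ≠ 0 :=
    ne_zero_of_mem_singImage_of_stalkIdeal_eq S.i.ker (stalkIdeal_eq_span_localGenerator S.i.ker y hXy) hygen.1
  have hg' : localGenerator S'.i.ker η' ∈ maximalIdeal (S'.Y.presheaf.stalk η') ^ 2 :=
    localGenerator_mem_sq_of_mem_singImage S'.i.ker η' hX'η hη'.1
  -- the two branches
  by_cases hsupp : y ∈ R.support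
  · exact S.iotaAt_lt_mu₂_of_succCompatible_overCentre ι J hiso hunit hgame k S' π hR hc η' hdim hη' hsupp hf0 hf2 hg'
  · exact S.iotaAt_lt_mu₂_of_succCompatible_offCentre ι J hiso hunit hc10 k S' π hR hc η' hdim hη' hsupp

end Summit.ResolutionOfSingularities.ResolutionOfSingularities.Theorems.ELadderOne.Stage

namespace Summit.ResolutionOfSingularities.ResolutionOfSingularities.Cruxes.HypersurfaceCentreConstruction.LocalEngine

open Summit.ResolutionOfSingularities.ResolutionOfSingularities.Theorems.ELadderOne

/-- **`E2InvSuccLocBody p ι J` under the graded HOM rung** (the SUPREMUM STEP over the pointwise drop): a compatible successor of a non-regular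
(I0)₂ stage along an admissible canonical e = 2 centre is regular or has strictly smaller `mu₂`. [folklore] -/
theorem e2InvSuccLoc (p : ℕ) (ι : (R : Type) → [CommRing R] → R → Ordinal.{0})
    (J : (R : Type) → [CommRing R] → R → ℕ → Ideal R) (hr : PRungGrHomLE 3 p ι J) : E2InvSuccLocBody p ι J := by
  intro k _ _ _ S _ _ R _ _ hR S' π hc
  by_cases hreg' : Scheme.IsRegular S'.X
  · exact Or.inl hreg'
  · right
    obtain ⟨η₀, hη₀, hmax⟩ := S'.exists_isMaxOn_iotaAt_genSing₂ ι J hr hc.invDim (S'.genSing₂_nonempty hc.invDim hreg')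
    rw [← (S'.mem_maxLocus₂_of_isMaxOn ι hη₀ hmax).2]
    exact Stage.iotaAt_lt_mu₂_of_succCompatible ι J hr S S' π hR hc hη₀

/-- **`stub_e2_inv_succ_loc_h` — the registered E2 LOCAL-DROP stub of skeleton v3.12, BY NAME.** [folklore] -/
theorem stub_e2_inv_succ_loc_h : ∀ p : ℕ, p.Prime →
    ∀ (ι : (R : Type) → [CommRing R] → R → Ordinal.{0}) (J : (R : Type) → [CommRing R] → R → ℕ → Ideal R),
      PRungGrHomLE 3 p ι J → E2InvSuccLocBody p ι J :=
  fun p _ ι J hr => e2InvSuccLoc p ι J hr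

end Summit.ResolutionOfSingularities.ResolutionOfSingularities.Cruxes.HypersurfaceCentreConstruction.LocalEngine

end
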